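import Literature.Computability.Complexity.BakerGillSolovay
import Literature.Computability.Complexity.MultilinearExtension
import Literature.Computability.Complexity.StructuralPH
import HarnessLib

/-!
# Aaronson–Wigderson Thm. 5.1: oracles `A, Ã` with `NP^Ã ⊆ P^A` (proof of `aaronson_wigderson_collapse`)

Trunk `CplxCore`, companion of `Algebrization.lean` / `StructuralPH.lean`. We PROVE, with no
hypothesis, the named fact `Literature.Computability.Complexity.aaronson_wigderson_collapse`
(`StructuralPH.lean`; S. Aaronson, A. Wigderson, *Algebrization: a new barrier in complexity
theory*, STOC 2008, full version Thm. 5.1, p. 23: "There exist `A, Ã` such that `NP^Ã ⊆ P^A`"),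
in the tree's transcript model of oracle computation (`PRel`, `NPRel`, `Oracle.ofLanguage`,
`ExtensionOracle.toOracle`):

* `Literature.Computability.Complexity.aaronson_wigderson_collapse_holds` —
  `∃ A Ã d, Ã.IsExtensionOf A d ∧ NP^Ã ⊆ P^A`, with `d = 1` and `Ã` THE multilinear extension of
  `A` over every prime field (`multilinearExtension`, `MultilinearExtension.lean`), as in AW's
  proof ("let `Ã` be the unique multilinear extension of `A`").

On the way, the collapse half of the Baker–Gill–Solovay construction of the tree
(`BGS.oracleA`, `BakerGillSolovay.lean`) is redone ONCE for an arbitrary *length-local oracle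
presentation* `Φ : Set (List Bool) → Oracle` (`LocalCollapse.IsLocal Φ`: the answer to a query
of length `< n` depends only on the strings of length `< n` of the language) —
`LocalCollapse.exists_NPRel_subset_PRel : IsLocal Φ → ∃ A, NP^{Φ A} ⊆ P^A` — of which both the
language oracle `A ↦ A` (`isLocal_ofLanguage`; BGS) and the multilinear extension `A ↦ Ã`
(`isLocal_multilinearExtension`; AW) are instances.

## The proof (same statement, a different witness `A`)

AW's printed proof (p. 23) takes `A` PSPACE-complete: "the multilinear extension of any PSPACE
language is also in PSPACE [Babai–Fortnow–Lund]. So as in the usual argument of Baker, Gill, and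
Solovay, `NP^Ã = NP^PSPACE = PSPACE = P^A`." The tree has no relativised `PSPACE` (nor a
`PSPACE`-complete language for the transcript model), so — exactly as for the tree's proof of the
first half of Baker–Gill–Solovay — the witness is built by the *encoding technique* instead
(Ko 1989, §5, p. 21: the `NP(A)`-complete set
`K(A) = {⟨0^i, a, 0^j⟩ | (∃ b, |b| ≤ j) [σᵢ(A; ⟨a, b⟩) is true and decidable in j moves]}`, whose
membership "depends only on the set `A_{<|x|}`"), relative to the presented oracle `Φ A`: the code
`c = ⟨1^i, ⟨1^k, ⟨1^t, x⟩⟩⟩` (`BGS.code`, of length `> t`) is put into `A` iff some `w` with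
`|w| ≤ k` makes the `i`-th polynomial-time oracle algorithm `Mᵢ` output `true` on `⟨x, w⟩` within
`t` rounds when its queries are answered by `Φ` OF THE PART OF `A` ALREADY CONSTRUCTED (strings
shorter than `c`; `LocalCollapse.below`, `LocalCollapse.oracleA`). For the multilinear extension
this recursion on the length is sound because (a) a query string of length `ℓ` to `Ã` concerns an
arity `n ≤ ℓ` (`arity_le_length_of_decode`), and (b) the arity-`n` polynomial of the multilinear
extension depends on `A ∩ {0,1}ⁿ` only (`multilinearExtension_poly_congr`;
`ExtensionOracle.toOracle_congr_of_length`): `isLocal_multilinearExtension`. So within `t < |c|`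
rounds, with queries of length `≤ t`, the machine sees the same answers from the stage oracle and
from `Φ A` (`LocalCollapse.apply_below`, `LocalCollapse.mem_oracleA_code_iff`). Then every
`L ∈ NP^{Φ A}` — `x ∈ L ⇔ ∃ y, |y| ≤ p|x|, ⟨x, y⟩ ∈ L'` with `L' ∈ P^{Φ A}` decided by `Mᵢ` within
`q` rounds, queries of length `≤ q` — Karp-reduces to `A` by the padding map
`x ↦ ⟨1^i, ⟨1^{p|x|}, ⟨1^{t|x|}, x⟩⟩⟩`, `t = q ∘ (2X + 2 + p)` (`BGS.redFn`, in `FP`), whence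
`L ∈ P^A` (`mem_PRel_of_karpReducible`, `self_mem_PRel_ofLanguage_holds`):
`LocalCollapse.NPRel_subset_PRel`. As in `BakerGillSolovay.lean`, no machine is simulated by a
machine: the universality sits in the (classical) definition of `A`. The witness differs from
AW's; the statement proved is theirs verbatim (as vendored in `StructuralPH.lean`).

## References

* S. Aaronson, A. Wigderson, *Algebrization: a new barrier in complexity theory*, STOC 2008 /
  ACM TOCT 1 (2009), Thm. 5.1 (full version p. 23), Def. 2.2, §4.1 [AaronsonWigderson2008].
* K.-I Ko, *Constructing oracles by lower bound techniques for circuits*, in: Combinatorics,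
  Computing and Complexity (Kluwer, 1989) 30–76, §5 (p. 21: the `NP(A)`-complete set `K(A)`)
  [Ko1989].
* T. Baker, J. Gill, R. Solovay, *Relativizations of the P =? NP question*, SIAM J. Comput. 4
  (1975) 431–442, §1 [BakerGillSolovay1975].
-/

namespace Literature.Computability.Complexity

open _root_.Computability Polynomial

namespace LocalCollapse

open scoped Notation

/-! ### Length-local oracle presentations -/

/-- `IsLocal Φ`: the oracle `Φ S` presented by a language `S` answers every query of length `< n`
in a way that depends only on the strings of length `< n` of `S` (Ko 1989, §5: membership in
`K(A)` "depends only on the set `A_{<|x|}`"). Instances: the language oracle itself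
(`isLocal_ofLanguage`) and the multilinear extension (`isLocal_multilinearExtension`).
[cite: Ko1989, §5 (p. 21)] -/
def IsLocal (Φ : Set (List Bool) → Oracle) : Prop :=
  ∀ ⦃S S' : Set (List Bool)⦄ ⦃n : ℕ⦄, (∀ w : List Bool, w.length < n → (w ∈ S ↔ w ∈ S')) →
    ∀ ⦃y : List Bool⦄, y.length < n → Φ S y = Φ S' y

/-- The language oracle `A ↦ (q ↦ [q ∈ A])` is length-local. [cite: BakerGillSolovay1975, §1] -/
theorem isLocal_ofLanguage : IsLocal Oracle.ofLanguage :=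
  fun _ _ _ h _ hy => Oracle.ofLanguage_apply_eq_of_iff (h _ hy)

/-- **The multilinear extension `A ↦ Ã` is length-local**: a query of length `ℓ < n` concerns an
arity `m ≤ ℓ` (`arity_le_length_of_decode`) and the arity-`m` polynomial depends only on the
strings of length `m` (`multilinearExtension_poly_congr`).
[cite: AaronsonWigderson2008, Def. 2.2 and §4.1] -/
theorem isLocal_multilinearExtension : IsLocal fun S => (multilinearExtension S).toOracle := by
  intro S S' n h y hy
  exact ExtensionOracle.toOracle_congr_of_length (ℓ := y.length)
    (fun p m hm => multilinearExtension_poly_congr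
      (sliceFn_congr fun w hw => h w (by omega)) p) le_rfl

variable (Φ : Set (List Bool) → Oracle) (e : ℕ → OracleAlg Bool)

/-! ### The collapsing oracle `A = K(Φ A)` -/

/-- `Holds Φ e S c`: `c` is a code `⟨1^i, ⟨1^k, ⟨1^t, x⟩⟩⟩` (`BGS.code`) and some witness `w` with
`|w| ≤ k` makes `e i` output `true` on `⟨x, w⟩` within `t` rounds when the queries are answered by
the oracle `Φ S` presented by the language `S` — membership of `c` in Ko's `K(S)` relative to the
presentation `Φ`. [cite: Ko1989, §5 (p. 21)] -/
def Holds (S : Set (List Bool)) (c : List Bool) : Prop :=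
  ∃ (i k t : ℕ) (x : List Bool), c = BGS.code i k t x ∧
    ∃ w : List Bool, w.length ≤ k ∧ (e i).run (Φ S) t (boolPair x w) = some true

/-- The stages of the collapsing oracle: `below Φ e n` is the set of its strings of length `< n`;
a string `c` of length `n` is added iff `c ∈ K(S)` for the stage language `S = below Φ e n`
(membership depends only on the strings shorter than `c`). [cite: Ko1989, §5 (p. 21)] -/
def below : ℕ → Set (List Bool)
  | 0 => ∅
  | n + 1 => below n ∪ {c | c.length = n ∧ Holds Φ e (below n) c}

/-- **The collapsing oracle `A` with `A = K(Φ A)`.** [cite: Ko1989, §5 (p. 21)] -/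
def oracleA : Set (List Bool) :=
  {c | c ∈ below Φ e (c.length + 1)}

/-- Strings of stage `n` are shorter than `n`. [folklore] -/
theorem length_lt_of_mem_below {n : ℕ} {c : List Bool} (h : c ∈ below Φ e n) : c.length < n := by
  induction n with
  | zero => simp [below] at h
  | succ n ih =>
    simp only [below, Set.mem_union, Set.mem_setOf_eq] at h
    rcases h with h | h
    · exact Nat.lt_succ_of_lt (ih h)
    · have : c.length = n := h.1
      omega

/-- The stages are cumulative: a string of length `< n` is in stage `n` iff it is in the stage
right after its own length. [folklore] -/
theorem mem_below_iff_of_lt {n : ℕ} {c : List Bool} (h : c.length < n) :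
    c ∈ below Φ e n ↔ c ∈ below Φ e (c.length + 1) := by
  induction n with
  | zero => omega
  | succ n ih =>
    rcases Nat.lt_succ_iff_lt_or_eq.1 h with hlt | heq
    · rw [← ih hlt]
      simp only [below]
      constructor
      · rintro (h' | h')
        · exact h'
        · exact absurd h'.1 (by
            change c.length ≠ n
            omega)
      · intro h'
        exact Or.inl h'
    · rw [heq]

/-- A string of length `< n` is in stage `n` iff it is in the oracle. [cite: Ko1989, §5 (p. 21)] -/
theorem mem_below_iff {n : ℕ} {c : List Bool} (h : c.length < n) :
    c ∈ below Φ e n ↔ c ∈ oracleA Φ e :=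
  mem_below_iff_of_lt Φ e h

/-- **The fixed-point equation `A = K(Φ A)`**: a string is in the oracle iff it is a code accepted
relative to the presented oracle of the part of `A` below its own length. [cite: Ko1989, §5 (p. 21)] -/
theorem mem_oracleA_iff (c : List Bool) : c ∈ oracleA Φ e ↔ Holds Φ e (below Φ e c.length) c := by
  change c ∈ below Φ e (c.length + 1) ↔ _
  simp only [below]
  constructor
  · rintro (h | h)
    · exact absurd (length_lt_of_mem_below Φ e h) (lt_irrefl _)
    · exact h.2
  · intro h
    exact Or.inr ⟨rfl, h⟩

variable {Φ}

/-- **Locality along the stages**: for a length-local presentation, a query of length `< n` is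
answered by the stage-`n` oracle exactly as by `Φ A`. [cite: Ko1989, §5 (p. 21)] -/
theorem apply_below (hΦ : IsLocal Φ) {n : ℕ} {y : List Bool} (hy : y.length < n) :
    Φ (below Φ e n) y = Φ (oracleA Φ e) y :=
  hΦ (fun _ hw => mem_below_iff Φ e hw) hy

/-- **Completeness of `A` for `NP^{Φ A}` along codes.** If `e i` decides `L'` relative to `Φ A`
within `q` rounds with queries of length `≤ q`, then for every round budget `T ≥ q(2|x| + 2 + k)`
the code `⟨1^i, ⟨1^k, ⟨1^T, x⟩⟩⟩` is in `A` iff `∃ w, |w| ≤ k ∧ ⟨x, w⟩ ∈ L'`: within `T` rounds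
the machine has answered, having asked only strings shorter than the code, on which the stage
oracle agrees with `Φ A`. [cite: Ko1989, §5 (p. 21)] -/
theorem mem_oracleA_code_iff (hΦ : IsLocal Φ) {i : ℕ} {L' : Language Bool} {q : Polynomial ℕ}
    (hq : ∀ z : List Bool,
      (e i).run (Φ (oracleA Φ e)) (q.eval z.length) z = some (L'.boolIndicator z) ∧
        ∀ y ∈ (e i).queries (Φ (oracleA Φ e)) (q.eval z.length) z, y.length ≤ q.eval z.length)
    {k T : ℕ} (x : List Bool) (hT : q.eval (2 * x.length + 2 + k) ≤ T) :
    BGS.code i k T x ∈ oracleA Φ e ↔ ∃ w : List Bool, w.length ≤ k ∧ boolPair x w ∈ L' := by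
  rw [mem_oracleA_iff]
  -- the run of `e i` on `⟨x, w⟩`, `|w| ≤ k`, within `T` rounds against the stage oracle
  have key : ∀ w : List Bool, w.length ≤ k →
      (e i).run (Φ (below Φ e (BGS.code i k T x).length)) T (boolPair x w) =
        some (L'.boolIndicator (boolPair x w)) := by
    intro w hw
    set z := boolPair x w with hz
    obtain ⟨hrun, hqs⟩ := hq z
    have hzq : q.eval z.length ≤ T := by
      refine le_trans (TM2Iter.eval_mono q ?_) hT
      rw [hz, length_boolPair]
      omega
    have hrunT := (e i).run_mono _ z hzq hrun
    rw [← hrunT]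
    refine (e i).run_congr fun y hy => ?_
    rw [(e i).queries_eq_of_run_eq_some _ z hzq hrun] at hy
    exact apply_below e hΦ (lt_of_le_of_lt ((hqs y hy).trans hzq) (BGS.lt_length_code i k T x))
  constructor
  · rintro ⟨i', k', t', x', hc, w, hw, hacc⟩
    obtain ⟨rfl, rfl, rfl, rfl⟩ := BGS.code_inj hc
    refine ⟨w, hw, ?_⟩
    rw [key w hw] at hacc
    exact (Set.mem_iff_boolIndicator _ _).2 (Option.some.inj hacc)
  · rintro ⟨w, hw, hmem⟩
    refine ⟨i, k, T, x, rfl, w, hw, ?_⟩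
    rw [key w hw, (Set.mem_iff_boolIndicator _ _).1 hmem]

/-- **`NP^{Φ A} ⊆ P^A` for the collapsing oracle**, provided `Φ` is length-local and the
sequence `e` contains every polynomial-time oracle algorithm: an `NP^{Φ A}` language Karp-reduces
to `A` by the padding map `BGS.redFn` (in `FP`), and `P^A` is closed under Karp reductions and
contains `A`. [cite: Ko1989, §5 (p. 21)] [cite: AaronsonWigderson2008, Thm. 5.1] -/
theorem NPRel_subset_PRel (hΦ : IsLocal Φ)
    (he : {M : OracleAlg Bool | M.IsPolyTime encodingBoolBool} ⊆ Set.range e) :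
    NPRel (Φ (oracleA Φ e)) ⊆ PRel (Oracle.ofLanguage (oracleA Φ e)) := by
  rintro L ⟨L', hL', p, hp⟩
  obtain ⟨M, hM, q, hq⟩ := hL'
  obtain ⟨i, hi⟩ := he hM
  -- round budget `t = q ∘ (2X + 2 + p)`
  set t : Polynomial ℕ := q.comp (C 2 * X + C 2 + p) with ht
  have ht_eval : ∀ n, t.eval n = q.eval (2 * n + 2 + p.eval n) := by
    intro n
    simp [ht, eval_comp]
  have hred : L ≤ₚ oracleA Φ e := by
    refine ⟨BGS.redFn i p t, BGS.redFn_mem_FP i p t, fun x => ?_⟩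
    rw [BGS.redFn_apply]
    refine (hp x).trans ?_
    subst hi
    exact (mem_oracleA_code_iff e hΦ hq x (by rw [ht_eval])).symm
  exact mem_PRel_of_karpReducible hred (self_mem_PRel_ofLanguage_holds _)

/-- **For every length-local oracle presentation `Φ` there is a language `A` with
`NP^{Φ A} ⊆ P^A`** (the enumeration of all polynomial-time oracle algorithms exists:
`BGS.exists_enum`). For `Φ = Oracle.ofLanguage` this is the first half of Baker–Gill–Solovay, for
the multilinear extension it is Aaronson–Wigderson's Thm. 5.1.
[cite: Ko1989, §5 (p. 21)] [cite: AaronsonWigderson2008, Thm. 5.1] -/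
theorem exists_NPRel_subset_PRel (hΦ : IsLocal Φ) :
    ∃ A : Language Bool, NPRel (Φ A) ⊆ PRel (Oracle.ofLanguage A) := by
  obtain ⟨e, he⟩ := BGS.exists_enum
  exact ⟨oracleA Φ e, NPRel_subset_PRel e hΦ he⟩

end LocalCollapse

/-! ### The theorem -/

/-- **Aaronson–Wigderson, Thm. 5.1** ("There exist `A, Ã` such that `NP^Ã ⊆ P^A`"; hence "any
proof of `P ≠ NP` will require non-algebrizing techniques"): discharge of the named fact
`aaronson_wigderson_collapse` (`StructuralPH.lean`) — there are an oracle language `A` and an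
extension `Ã` of `A` of multidegree `≤ d` over the prime fields (here `d = 1`: `Ã` is the
multilinear extension of `A`, as in AW's proof) with `NPRel Ã.toOracle ⊆ PRel (Oracle.ofLanguage A)`.
Witness: the encoding-technique oracle `A = K(Ã)` (`LocalCollapse.oracleA` for the length-local
presentation `A ↦ Ã`, `LocalCollapse.isLocal_multilinearExtension`) against the enumeration of all
polynomial-time oracle algorithms; AW's own witness (a PSPACE-complete `A`) is not available in
the tree, see the module docstring. Axioms: `propext`, `Classical.choice`, `Quot.sound`.
[cite: AaronsonWigderson2008, Thm. 5.1 (full version p. 23)] -/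
theorem aaronson_wigderson_collapse_holds : aaronson_wigderson_collapse := by
  obtain ⟨A, hA⟩ := LocalCollapse.exists_NPRel_subset_PRel LocalCollapse.isLocal_multilinearExtension
  exact ⟨A, multilinearExtension A, 1, multilinearExtension_isExtensionOf A, hA⟩

/-- The same theorem with the witnesses named: for the multilinear extension `Ã` (multidegree
`≤ 1`) of the encoding oracle `A`, `NP^Ã ⊆ P^A`. [cite: AaronsonWigderson2008, Thm. 5.1] -/
theorem exists_multilinearExtension_NPRel_subset_PRel :
    ∃ A : Language Bool, (multilinearExtension A).IsExtensionOf A 1 ∧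
      NPRel (multilinearExtension A).toOracle ⊆ PRel (Oracle.ofLanguage A) := by
  obtain ⟨A, hA⟩ := LocalCollapse.exists_NPRel_subset_PRel LocalCollapse.isLocal_multilinearExtension
  exact ⟨A, multilinearExtension_isExtensionOf A, hA⟩

/-! ### The Baker–Gill–Solovay collapse is the language-oracle instance -/

/-- `BGS.Holds` (`BakerGillSolovay.lean`) is `LocalCollapse.Holds` at the presentation
`Φ = Oracle.ofLanguage` (definitionally). [cite: Ko1989, §5 (p. 21)] -/
theorem BGS.holds_iff_localCollapse (e : ℕ → OracleAlg Bool) (S : Set (List Bool)) (c : List Bool) :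
    BGS.Holds e S c ↔ LocalCollapse.Holds Oracle.ofLanguage e S c :=
  Iff.rfl

/-- `BGS.below` is `LocalCollapse.below` at `Φ = Oracle.ofLanguage`. [cite: Ko1989, §5 (p. 21)] -/
theorem BGS.below_eq_localCollapse (e : ℕ → OracleAlg Bool) (n : ℕ) :
    BGS.below e n = LocalCollapse.below Oracle.ofLanguage e n := by
  induction n with
  | zero => rfl
  | succ n ih =>
    show BGS.below e n ∪ {c | c.length = n ∧ BGS.Holds e (BGS.below e n) c} =
      LocalCollapse.below Oracle.ofLanguage e n ∪
        {c | c.length = n ∧ LocalCollapse.Holds Oracle.ofLanguage e (LocalCollapse.below Oracle.ofLanguage e n) c}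
    rw [ih]
    rfl

/-- **The Baker–Gill–Solovay collapsing oracle `BGS.oracleA` is the encoding oracle
`LocalCollapse.oracleA` for the language-oracle presentation** (so `BGS.NPRel_oracleA_subset` is
the instance `Φ = Oracle.ofLanguage` of `LocalCollapse.NPRel_subset_PRel`).
[cite: Ko1989, §5 (p. 21)] [cite: AroraBarakCC2009, Thm. 3.7] -/
theorem BGS.oracleA_eq_localCollapse (e : ℕ → OracleAlg Bool) :
    BGS.oracleA e = LocalCollapse.oracleA Oracle.ofLanguage e := by
  ext c
  show c ∈ BGS.below e (c.length + 1) ↔ c ∈ LocalCollapse.below Oracle.ofLanguage e (c.length + 1)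
  rw [BGS.below_eq_localCollapse]

/-- The first half of Baker–Gill–Solovay as the instance `Φ = Oracle.ofLanguage` of
`LocalCollapse.exists_NPRel_subset_PRel`: some `A` has `NP^A ⊆ P^A`.
[cite: AroraBarakCC2009, Thm. 3.7] [cite: Ko1989, §5 (p. 21)] -/
theorem exists_NPRel_subset_PRel_ofLanguage :
    ∃ A : Language Bool, NPRel (Oracle.ofLanguage A) ⊆ PRel (Oracle.ofLanguage A) :=
  LocalCollapse.exists_NPRel_subset_PRel LocalCollapse.isLocal_ofLanguage

end Literature.Computability.Complexity
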